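import Summits.BirchSwinnertonDyer.Rank1Residual.Additive.RamifiedSevenGenusUnitSide
import Literature.NumberTheory.IwasawaTheory.IwasawaAlgebraArtinElementFamily
import Mathlib.NumberTheory.LegendreSymbol.JacobiSymbol
import HarnessLib

set_option autoImplicit false

/-!
# `𝒞₇` genus road (crux `EllipticUnitValueSevenOfGZK`, K7r), the (5)-unit programme (SUMMON GENUS-UNIT-A6), File E3a:
# THE `η₁`-READING `R_n(a) = C(χ_D(a)ω(a)⁵)·(1+T)^{r_n(a)}` OF `σ_a` MODULO `h_n = (1+T)^{7ⁿ} − 1`, THE LEGENDRE SYMBOL AT `7`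
# AS `ω³`, AND LANG'S STICKELBERGER LAYER OVER THE UNITS OF `ℤ/mₙ` (THEOREMS ONLY)

Cell bsd-cm, seat bsd-cm-k-ty1 g27 (literature-prover); SUMMON `wake/SUMMON-bsd-cm-k-ty1-20260830T2140Z.md` (planner g36,
D972) block (A6-3) = File E, THIRD brick, first half (the toolkit of E3b `RamifiedSevenGenusStickelbergerReading.lean`).
Pure `Λ = ℤ₇⟦T⟧`-algebra on the frame `F` (no module, no Galois group).

* §1 THE READING `R_n(a) = C(χ_D(a)·ω(a)⁵)·(1+T)^{r_n(a)}` (spelled out through a hypothesis `hR`, no definition): it is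
  multiplicative and `mₙ`-periodic modulo `h_n` and `R_n(1) ≡ 1` (`reading_mul_sub_mem`, `reading_mod_sub_mem`,
  `reading_one_sub_mem`; on the units of `ℤ/mₙ`: `reading_units_mul_sub_mem`, `reading_units_one_sub_mem`) — the tree's
  `IsLogTable.one_add_X_pow_mul_sub_mem` / `one_add_X_pow_mod_sub_mem` dressed with the prime-to-`7|D|` characters.
* §2 `omega_apply_pow_six`, `chiD_apply_sq`, ★ `intCast_jacobiSym_eq_omega_pow_three` (`(a/7) = ω(a)³` in `ℤ₇`: Euler's
  criterion read through the Teichmüller congruence), `jacobiSym_val_mul` / `jacobiSym_val_unitOfCoprime` (the Legendre symbol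
  of the residues is a character of `(ℤ/mₙ)ˣ`, `7 ∣ mₙ`), `etaOneDirichlet_apply_natCast` (`η₁(a) = χ_D(a)ω(a)⁵`),
  `oddBranchSeven_reading` (the summand of Lang's layer against `R_n`: `ψ(a)·a·(1+T)^{rInv_n(a)}·R_n(a) ≡ (a/7)·a`, `ψ = ω⁴χ_D`).
* §3 `sum_units_eq_sum_filter_coprime` (the units of `ℤ/mₙ` ↔ Lang's index set `{a < |D|·7^{n+1}, (a, 7|D|) = 1}`),
  `stickelbergerLayer_eq_sum_units`; §4 `isUnit_natCast_d`, `mem_span_layerModulus_of_C_level_mul_mem` (cancellation of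
  `C(mₙ)` modulo `h_n`, `layerModulus_dvd_of_dvd_C_pow_mul`), `natCast_level_mul_div` (`mₙ·⌊N c̄/mₙ⌋ = N c̄ − (Nc)‾`).

HONEST LABEL: ring bookkeeping; no definition, no named fact, no instance; nothing closes; stmt-BirchSwinnertonDyer-19945 OPEN;
K1ᵘ NOT proved; `X12.CMRamifiedSeven` NOT proved; no summit statement is proved by this seat; BSD is claimed for no curve.

## References
* S. Lang, *Cyclotomic Fields I–II* (1990) Ch. 1 §2, Ch. 5 §1 Thm 1.1, Ch. 10 §1 Thm 1.2, §2 (2)–(3) (PDF pp. 14–16, 115–116,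
  167–168, 171) [Lang1990]; L. Washington, *Introduction to Cyclotomic Fields* (1997) §6.2, §7.2 Thm 7.10, Ch. 14 [Washington1997];
  T. Tsuji, J. Number Theory 78 (1999) §4 (p. 12, «χ = φω^i») [Tsuji1999]; K. Ireland, M. Rosen, GTM 84, Ch. 5 §2 Prop. 5.2.2
  (Euler's criterion) [IrelandRosen1990].
* Tree: `IwasawaTheory/StickelbergerSeries.lean`, `StickelbergerSeriesExistence.lean` (`one_add_X_pow_mul_sub_mem`,
  `one_add_X_pow_mod_sub_mem`, `oddBranch_apply_mul_apply`), `IwasawaAlgebraArtinElementFamily.lean`,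
  `RamifiedSevenGenusFactorisationShape.lean` (the frame).
-/

noncomputable section

open scoped NumberField
open PowerSeries IsDedekindDomain
open Literature.NumberTheory.EllipticCurves
open Literature.NumberTheory.EllipticCurves.IwasawaAlgebra
open Literature.NumberTheory.IwasawaTheory
open Literature.NumberTheory.IwasawaTheory.StickelbergerSeries
open Literature.NumberTheory.ComplexMultiplication.EllipticUnits
open NumberTheorySymbols

namespace Summit.BirchSwinnertonDyer.Rank1Residual.Additive.GenusSeven

namespace GenusFrame

variable (F : GenusFrame)

/-! ## §1 The `η₁`-reading `R_n(a) = C(χ_D(a)ω(a)⁵)·(1+T)^{r_n(a)}` modulo `h_n` -/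

/-- **Multiplicativity**: `R_n(aa') ≡ R_n(a)·R_n(a') (mod h_n)` for `a, a'` prime to `7` (`σ_{aa'} = σ_aσ_{a'}`).
[cite: Lang1990, Ch. 10 §1 Thm 1.2 (PDF p. 168)] -/
theorem reading_mul_sub_mem (n : ℕ) (R : ℕ → IwasawaAlgebra 7)
    (hR : ∀ a : ℕ, R a = C (F.χD (a : ZMod F.d) * F.ω (a : ZMod 7) ^ 5) * (1 + X) ^ F.r n a)
    {a a' : ℕ} (ha : a.Coprime 7) (ha' : a'.Coprime 7) :
    R (a * a') - R a * R a' ∈ Ideal.span {layerModulus 7 n} := by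
  haveI : Fact (Nat.Prime 7) := ⟨Nat.prime_seven⟩
  have h := F.r_logTable.one_add_X_pow_mul_sub_mem (by decide) F.u_topGenerator (n := n) ha ha'
  have e : R (a * a') - R a * R a' = C (F.χD ((a * a' : ℕ) : ZMod F.d) * F.ω ((a * a' : ℕ) : ZMod 7) ^ 5) *
      ((1 + X) ^ F.r n (a * a') - (1 + X) ^ F.r n a * (1 + X) ^ F.r n a') := by
    rw [hR, hR, hR]
    simp only [Nat.cast_mul, map_mul, mul_pow]
    ring
  rw [e]
  exact Ideal.mul_mem_left _ _ h

/-- **Periodicity**: `R_n(a mod mₙ) ≡ R_n(a) (mod h_n)`, `mₙ = 7^{n+1}|D|`, for `a` prime to `7` (`χ_D`, `ω` have levels `|D|`, `7`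
dividing `mₙ`; the `γ`-part by `one_add_X_pow_mod_sub_mem`). [cite: Lang1990, Ch. 10 §1 Thm 1.2 (PDF p. 168)] -/
theorem reading_mod_sub_mem (n : ℕ) (R : ℕ → IwasawaAlgebra 7)
    (hR : ∀ a : ℕ, R a = C (F.χD (a : ZMod F.d) * F.ω (a : ZMod 7) ^ 5) * (1 + X) ^ F.r n a)
    {a : ℕ} (ha : a.Coprime 7) :
    R (a % (7 ^ (n + 1) * F.d)) - R a ∈ Ideal.span {layerModulus 7 n} := by
  haveI : Fact (Nat.Prime 7) := ⟨Nat.prime_seven⟩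
  have h := F.r_logTable.one_add_X_pow_mod_sub_mem (by decide) F.u_topGenerator (n := n) (N := 7 ^ (n + 1) * F.d)
    (Dvd.intro _ rfl) ha
  have hd : ((a % (7 ^ (n + 1) * F.d) : ℕ) : ZMod F.d) = (a : ZMod F.d) := by
    rw [ZMod.natCast_eq_natCast_iff', Nat.mod_mod_of_dvd a (Dvd.intro_left _ rfl)]
  have h7 : ((a % (7 ^ (n + 1) * F.d) : ℕ) : ZMod 7) = (a : ZMod 7) := by
    rw [ZMod.natCast_eq_natCast_iff', Nat.mod_mod_of_dvd a ((dvd_pow_self 7 (Nat.succ_ne_zero n)).mul_right _)]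
  rw [hR, hR, hd, h7, ← mul_sub]
  exact Ideal.mul_mem_left _ _ h

/-- **`R_n(1) ≡ 1 (mod h_n)`** (`u^{r_n(1)} ≡ 1`, so `7ⁿ ∣ r_n(1)`). [cite: Lang1990, Ch. 10 §1 Thm 1.2 (PDF p. 168)] -/
theorem reading_one_sub_mem (n : ℕ) (R : ℕ → IwasawaAlgebra 7)
    (hR : ∀ a : ℕ, R a = C (F.χD (a : ZMod F.d) * F.ω (a : ZMod 7) ^ 5) * (1 + X) ^ F.r n a) :
    R 1 - 1 ∈ Ideal.span {layerModulus 7 n} := by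
  haveI : Fact (Nat.Prime 7) := ⟨Nat.prime_seven⟩
  have h1 : (F.u : ℤ_[7]) ^ F.r n 1 * 1 - 1 ∈ Ideal.span {((7 : ℕ) : ℤ_[7]) ^ (n + 1)} := by
    have h := F.r_logTable n 1 (Nat.coprime_one_left 7)
    rwa [Nat.cast_one, Nat.cast_one, map_one] at h
  have h0 : (F.u : ℤ_[7]) ^ 0 * 1 - 1 ∈ Ideal.span {((7 : ℕ) : ℤ_[7]) ^ (n + 1)} := by
    rw [pow_zero, mul_one, sub_self]; exact zero_mem _
  have h := one_add_X_pow_sub_pow_mem_of_congr (p := 7) (by decide) F.u_topGenerator isUnit_one h1 h0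
  rw [pow_zero] at h
  rw [hR, Nat.cast_one, Nat.cast_one, map_one, map_one, one_pow, mul_one, map_one, one_mul]
  exact h

/-- The residues of the units of `ℤ/mₙ` are prime to `7`. [cite: Lang1990, Ch. 10 §1 (PDF p. 167)] -/
theorem val_coprime_seven (n : ℕ) (g : (ZMod (7 ^ (n + 1) * F.d))ˣ) :
    ((g : ZMod (7 ^ (n + 1) * F.d))).val.Coprime 7 :=
  (ZMod.val_coe_unit_coprime g).coprime_dvd_right ((dvd_pow_self 7 (Nat.succ_ne_zero n)).mul_right _)

/-- The residues of the units of `ℤ/mₙ` are prime to `|D|`. [cite: Lang1990, Ch. 10 §1 (PDF p. 167)] -/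
theorem val_coprime_d (n : ℕ) (g : (ZMod (7 ^ (n + 1) * F.d))ˣ) :
    ((g : ZMod (7 ^ (n + 1) * F.d))).val.Coprime F.d :=
  (ZMod.val_coe_unit_coprime g).coprime_dvd_right (Dvd.intro_left _ rfl)

/-- The residues of the units of `ℤ/mₙ` are prime to `7|D|`. [cite: Lang1990, Ch. 10 §1 (PDF p. 167)] -/
theorem val_coprime_d_mul_seven (n : ℕ) (g : (ZMod (7 ^ (n + 1) * F.d))ˣ) :
    ((g : ZMod (7 ^ (n + 1) * F.d))).val.Coprime (F.d * 7) :=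
  Nat.Coprime.mul_right (F.val_coprime_d n g) (F.val_coprime_seven n g)

/-- **On `(ℤ/mₙ)ˣ` the reading is multiplicative modulo `h_n`**: `R_n((gg')‾) ≡ R_n(ḡ)R_n(ḡ')`.
[cite: Lang1990, Ch. 10 §1 Thm 1.2 (PDF p. 168)] -/
theorem reading_units_mul_sub_mem (n : ℕ) (R : ℕ → IwasawaAlgebra 7)
    (hR : ∀ a : ℕ, R a = C (F.χD (a : ZMod F.d) * F.ω (a : ZMod 7) ^ 5) * (1 + X) ^ F.r n a)
    (g g' : (ZMod (7 ^ (n + 1) * F.d))ˣ) :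
    R ((g * g' : (ZMod (7 ^ (n + 1) * F.d))ˣ) : ZMod (7 ^ (n + 1) * F.d)).val -
        R ((g : ZMod (7 ^ (n + 1) * F.d))).val * R ((g' : ZMod (7 ^ (n + 1) * F.d))).val ∈
      Ideal.span {layerModulus 7 n} := by
  rw [Units.val_mul, ZMod.val_mul]
  have h1 := F.reading_mod_sub_mem n R hR (a := ((g : ZMod (7 ^ (n + 1) * F.d))).val * ((g' : ZMod (7 ^ (n + 1) * F.d))).val)
    (Nat.Coprime.mul_left (F.val_coprime_seven n g) (F.val_coprime_seven n g'))
  have h2 := F.reading_mul_sub_mem n R hR (F.val_coprime_seven n g) (F.val_coprime_seven n g')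
  have := Ideal.add_mem _ h1 h2
  rwa [sub_add_sub_cancel] at this

/-- `R_n(1̄) ≡ 1 (mod h_n)` on `(ℤ/mₙ)ˣ`. [cite: Lang1990, Ch. 10 §1 Thm 1.2 (PDF p. 168)] -/
theorem reading_units_one_sub_mem (n : ℕ) (R : ℕ → IwasawaAlgebra 7)
    (hR : ∀ a : ℕ, R a = C (F.χD (a : ZMod F.d) * F.ω (a : ZMod 7) ^ 5) * (1 + X) ^ F.r n a) :
    R ((1 : (ZMod (7 ^ (n + 1) * F.d))ˣ) : ZMod (7 ^ (n + 1) * F.d)).val - 1 ∈ Ideal.span {layerModulus 7 n} := by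
  haveI : Fact (1 < 7 ^ (n + 1) * F.d) := ⟨F.one_lt_level n⟩
  rw [Units.val_one, ZMod.val_one]
  exact F.reading_one_sub_mem n R hR

/-! ## §2 `ω⁶ = 1`, the Legendre symbol at `7` is `ω³`, `η₁(a) = χ_D(a)ω(a)⁵`, and the summand of Lang's layer -/

/-- `ω(a)⁶ = 1` for `a` prime to `7`. [cite: Washington1997, Ch. 14 (p. 321, Teichmüller character)] -/
theorem omega_apply_pow_six {a : ℕ} (ha : a.Coprime 7) : F.ω (a : ZMod 7) ^ 6 = 1 := by
  haveI : NeZero (7 : ℕ) := ⟨by norm_num⟩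
  rw [← map_pow, ← ZMod.coe_unitOfCoprime a ha, ← Units.val_pow_eq_pow_val, show (6 : ℕ) = Nat.totient 7 by decide,
    ZMod.pow_totient, Units.val_one, map_one]

/-- `χ_D(a)² = 1` for `a` prime to `|D|` (`χ_D` is quadratic). [cite: Lang1990, Ch. 3 §2 (PDF p. 61, quadratic characters)] -/
theorem chiD_apply_sq {a : ℕ} (ha : a.Coprime F.d) : F.χD (a : ZMod F.d) ^ 2 = 1 := by
  have hu : IsUnit (a : ZMod F.d) := by rw [← ZMod.coe_unitOfCoprime a ha]; exact Units.isUnit _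
  have h := congrArg (fun χ : DirichletCharacter ℤ_[7] F.d => χ (a : ZMod F.d)) F.χD_mul_self
  simp only [MulChar.mul_apply] at h
  rw [sq, h, MulChar.one_apply hu]

/-- ★ **The Legendre symbol at `7` is `ω³` in `ℤ₇`**: `(a/7) = ω(a)³` for `a` prime to `7` — Euler's criterion `(a/7) ≡ a³`,
the Teichmüller congruence `ω(a) ≡ a (mod 7)`, and `(a/7), ω(a)³ ∈ {±1}` with `1 ≢ −1 (mod 7)`.
[cite: IrelandRosen1990, Ch. 5 §2 Prop. 5.2.2] [cite: Washington1997, Ch. 14 (p. 321)] -/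
theorem intCast_jacobiSym_eq_omega_pow_three {a : ℕ} (ha : a.Coprime 7) :
    ((J((a : ℤ) | 7) : ℤ) : ℤ_[7]) = F.ω (a : ZMod 7) ^ 3 := by
  haveI : Fact (Nat.Prime 7) := ⟨Nat.prime_seven⟩
  -- both sides are `±1`
  have hω : F.ω (a : ZMod 7) ^ 3 = 1 ∨ F.ω (a : ZMod 7) ^ 3 = -1 := by
    apply mul_self_eq_one_iff.mp
    rw [← pow_add]
    exact F.omega_apply_pow_six ha
  have hJ : J((a : ℤ) | 7) = 1 ∨ J((a : ℤ) | 7) = -1 :=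
    jacobiSym.eq_one_or_neg_one (by rw [Int.gcd_natCast_natCast]; exact ha)
  -- and congruent modulo `7`
  have hcong : ((7 : ℕ) : ℤ_[7]) ∣ F.ω (a : ZMod 7) ^ 3 - ((J((a : ℤ) | 7) : ℤ) : ℤ_[7]) := by
    rw [← Ideal.mem_span_singleton, ← PadicInt.maximalIdeal_eq_span_p, ← PadicInt.ker_toZMod, RingHom.mem_ker,
      map_sub, map_pow, map_intCast, ← jacobiSym.legendreSym.to_jacobiSym, legendreSym.eq_pow,
      show (7 / 2 : ℕ) = 3 by norm_num, Int.cast_natCast, sub_eq_zero]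
    have ht := F.ω_teichmuller (ZMod.unitOfCoprime a ha)
    rw [ZMod.coe_unitOfCoprime] at ht
    rw [ht]
  have h2 : ¬ ((7 : ℕ) : ℤ_[7]) ∣ ((2 : ℤ) : ℤ_[7]) := by
    rw [← PadicInt.norm_lt_one_iff_dvd, PadicInt.norm_int_lt_one_iff_dvd]
    decide
  rcases hω with hω | hω <;> rcases hJ with hJ | hJ <;> rw [hω, hJ] <;> rw [hω, hJ] at hcong
  · rw [Int.cast_one]
  · exfalso; apply h2
    rwa [show (1 : ℤ_[7]) - ((-1 : ℤ) : ℤ_[7]) = ((2 : ℤ) : ℤ_[7]) by push_cast; ring] at hcong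
  · exfalso; apply h2
    rw [show (-1 : ℤ_[7]) - ((1 : ℤ) : ℤ_[7]) = -((2 : ℤ) : ℤ_[7]) by push_cast; ring, dvd_neg] at hcong
    exact hcong
  · rw [Int.cast_neg, Int.cast_one]

/-- **The Legendre symbol of the residues is a character of `(ℤ/mₙ)ˣ`** (`7 ∣ mₙ`): `((cc')‾/7) = (c̄/7)(c̄'/7)`.
[cite: IrelandRosen1990, Ch. 5 §2 Prop. 5.2.2] -/
theorem jacobiSym_val_mul (n : ℕ) (c c' : (ZMod (7 ^ (n + 1) * F.d))ˣ) :
    J((((c * c' : (ZMod (7 ^ (n + 1) * F.d))ˣ) : ZMod (7 ^ (n + 1) * F.d)).val : ℤ) | 7) =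
      J((((c : ZMod (7 ^ (n + 1) * F.d))).val : ℤ) | 7) * J((((c' : ZMod (7 ^ (n + 1) * F.d))).val : ℤ) | 7) := by
  have h7 : 7 ∣ 7 ^ (n + 1) * F.d := (dvd_pow_self 7 (Nat.succ_ne_zero n)).mul_right _
  rw [Units.val_mul, ZMod.val_mul, ← jacobiSym.mul_left, jacobiSym.mod_left _ 7,
    jacobiSym.mod_left ((((c : ZMod (7 ^ (n + 1) * F.d))).val : ℤ) * _) 7]
  congr 1
  rw [Int.natCast_mod, Int.natCast_mul, Int.emod_emod_of_dvd _ (Int.natCast_dvd_natCast.mpr h7)]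

/-- `(N c)‾/7 = (N/7)·(c̄/7)` for `N` prime to `mₙ` read as a unit `N̄` of `ℤ/mₙ`. [cite: IrelandRosen1990, Ch. 5 §2 Prop. 5.2.2] -/
theorem jacobiSym_val_unitOfCoprime (n : ℕ) {N : ℕ} (hN : N.Coprime (7 ^ (n + 1) * F.d)) :
    J((((ZMod.unitOfCoprime N hN : (ZMod (7 ^ (n + 1) * F.d))ˣ) : ZMod (7 ^ (n + 1) * F.d)).val : ℤ) | 7) =
      J((N : ℤ) | 7) := by
  have h7 : 7 ∣ 7 ^ (n + 1) * F.d := (dvd_pow_self 7 (Nat.succ_ne_zero n)).mul_right _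
  rw [ZMod.coe_unitOfCoprime, ZMod.val_natCast, jacobiSym.mod_left _ 7, jacobiSym.mod_left (N : ℤ) 7]
  congr 1
  rw [Int.natCast_mod, Int.emod_emod_of_dvd _ (Int.natCast_dvd_natCast.mpr h7)]

/-- **`η₁(a) = χ_D(a)·ω(a)⁵`** for `a` prime to `7|D|` (the Dirichlet character `etaOneDirichlet` mod `|D|·7` evaluated).
[cite: Lang1990, Ch. 10 §2 (PDF p. 171, «θ = even character on ℤ(dp)*»)] [cite: Tsuji1999, §4 (p. 12, «χ = φω^i»)] -/
theorem etaOneDirichlet_apply_natCast {a : ℕ} (ha : a.Coprime (F.d * 7)) :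
    F.etaOneDirichlet (a : ZMod (F.d * 7)) = F.χD (a : ZMod F.d) * F.ω (a : ZMod 7) ^ 5 := by
  rw [F.etaOneDirichlet_def, MulChar.mul_apply, MulChar.pow_apply' _ (by norm_num : (5 : ℕ) ≠ 0)]
  have hI : IsCoprime (a : ℤ) (F.d * 7 : ℕ) := Nat.isCoprime_iff_coprime.mpr ha
  have h1 := DirichletCharacter.changeLevel_eq_cast_of_dvd' F.χD (Dvd.intro 7 rfl) hI
  have h2 := DirichletCharacter.changeLevel_eq_cast_of_dvd' F.ω (Dvd.intro_left F.d rfl) hI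
  push_cast at h1 h2
  rw [h1, h2]

/-- **The summand of Lang's layer read against `R_n`**: for `a` prime to `7|D|`, with `ψ = ω⁴χ_D = η₁ω⁻¹` (`oddBranchSeven`),
`C(ψ(a)·a)·(1+T)^{rInv_n(a)} · R_n(a) ≡ C((a/7)·a) (mod h_n)` — `ψ·η₁ = χ_D²ω⁹ = ω³ = (·/7)` and
`(1+T)^{rInv_n(a)}(1+T)^{r_n(a)} = (1+T)^{7ⁿ r_n(a)} ≡ 1`. [cite: Lang1990, Ch. 10 §1 Thm 1.2 and §2 (2)–(3) (PDF pp. 168, 171)] -/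
theorem oddBranchSeven_reading (n : ℕ) (R : ℕ → IwasawaAlgebra 7)
    (hR : ∀ a : ℕ, R a = C (F.χD (a : ZMod F.d) * F.ω (a : ZMod 7) ^ 5) * (1 + X) ^ F.r n a)
    {a : ℕ} (ha : a.Coprime (F.d * 7)) :
    C (F.oddBranchSeven (a : ZMod (F.d * 7)) * (a : ℤ_[7])) * (1 + X) ^ F.rInv n a * R a -
      C (((J((a : ℤ) | 7) : ℤ) : ℤ_[7]) * (a : ℤ_[7])) ∈ Ideal.span {layerModulus 7 n} := by
  haveI : Fact (Nat.Prime 7) := ⟨Nat.prime_seven⟩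
  have ha7 : a.Coprime 7 := Nat.Coprime.coprime_mul_left_right ha
  have had : a.Coprime F.d := Nat.Coprime.coprime_mul_right_right ha
  -- the scalar: `ψ(a)·χ_D(a)ω(a)⁵ = (ψ(a)ω(a))·χ_D(a)ω(a)⁴ = χ_D(a)²ω(a)⁹ = ω(a)³ = (a/7)`
  have hscal : F.oddBranchSeven (a : ZMod (F.d * 7)) * (F.χD (a : ZMod F.d) * F.ω (a : ZMod 7) ^ 5) =
      ((J((a : ℤ) | 7) : ℤ) : ℤ_[7]) := by
    have h1 : F.oddBranchSeven (a : ZMod (F.d * 7)) * F.ω (a : ZMod 7) = F.χD (a : ZMod F.d) * F.ω (a : ZMod 7) ^ 5 := by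
      rw [F.oddBranchSeven_def, oddBranch_apply_mul_apply F.etaOneDirichlet F.ω ha, F.etaOneDirichlet_apply_natCast ha]
    have e : F.oddBranchSeven (a : ZMod (F.d * 7)) * (F.χD (a : ZMod F.d) * F.ω (a : ZMod 7) ^ 5) =
        (F.oddBranchSeven (a : ZMod (F.d * 7)) * F.ω (a : ZMod 7)) * F.χD (a : ZMod F.d) * F.ω (a : ZMod 7) ^ 4 := by ring
    rw [e, h1, F.intCast_jacobiSym_eq_omega_pow_three ha7]
    have e2 : F.χD (a : ZMod F.d) * F.ω (a : ZMod 7) ^ 5 * F.χD (a : ZMod F.d) * F.ω (a : ZMod 7) ^ 4 =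
        F.χD (a : ZMod F.d) ^ 2 * F.ω (a : ZMod 7) ^ 6 * F.ω (a : ZMod 7) ^ 3 := by ring
    rw [e2, F.chiD_apply_sq had, F.omega_apply_pow_six ha7, one_mul, one_mul]
  -- the `γ`-part: `(1+T)^{rInv}·(1+T)^{r} ≡ 1`
  have hγ : ((1 + X : IwasawaAlgebra 7) ^ F.rInv n a * (1 + X) ^ F.r n a - 1) ∈ Ideal.span {layerModulus 7 n} := by
    apply one_add_X_pow_mul_pow_sub_one_mem_span_layerModulus
    rw [F.rInv_def, Nat.sub_one_mul, Nat.sub_add_cancel (Nat.le_mul_of_pos_left (F.r n a) (by positivity))]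
    exact Dvd.intro _ rfl
  have e : C (F.oddBranchSeven (a : ZMod (F.d * 7)) * (a : ℤ_[7])) * (1 + X) ^ F.rInv n a * R a -
      C (((J((a : ℤ) | 7) : ℤ) : ℤ_[7]) * (a : ℤ_[7])) =
      C (((J((a : ℤ) | 7) : ℤ) : ℤ_[7]) * (a : ℤ_[7])) * ((1 + X : IwasawaAlgebra 7) ^ F.rInv n a * (1 + X) ^ F.r n a - 1) := by
    rw [hR, ← hscal]
    simp only [map_mul]
    ring
  rw [e]
  exact Ideal.mul_mem_left _ _ hγ

/-! ## §3 The units of `ℤ/mₙ` and Lang's index set -/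

/-- **`(ℤ/mₙ)ˣ ↔ {a < |D|·7^{n+1} : (a, 7|D|) = 1}`** by `g ↦ ḡ` (the residue in `[0, mₙ)`): sums over the units of `ℤ/mₙ`
are Lang's sums over the prime-to-`7|D|` residues. [cite: Lang1990, Ch. 10 §2 (2)–(3) (PDF p. 171, «u ∈ ℤ(dp^{n+1})*»)] -/
theorem sum_units_eq_sum_filter_coprime {M : Type*} [AddCommMonoid M] (n : ℕ) [NeZero (7 ^ (n + 1) * F.d)] (f : ℕ → M) :
    ∑ g : (ZMod (7 ^ (n + 1) * F.d))ˣ, f ((g : ZMod (7 ^ (n + 1) * F.d))).val =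
      ∑ a ∈ (Finset.range (F.d * 7 ^ (n + 1))).filter (fun a => a.Coprime (F.d * 7)), f a := by
  have hlev : F.d * 7 ^ (n + 1) = 7 ^ (n + 1) * F.d := Nat.mul_comm _ _
  have hdvd : F.d * 7 ∣ 7 ^ (n + 1) * F.d := ⟨7 ^ n, by ring⟩
  have hcop : ∀ a : ℕ, a.Coprime (F.d * 7) → a.Coprime (7 ^ (n + 1) * F.d) := fun a h =>
    Nat.Coprime.mul_right (Nat.Coprime.pow_right _ (Nat.Coprime.coprime_mul_left_right h))
      (Nat.Coprime.coprime_mul_right_right h)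
  refine Finset.sum_bij' (fun g _ => ((g : ZMod (7 ^ (n + 1) * F.d))).val)
    (fun a ha => ZMod.unitOfCoprime a (hcop a (Finset.mem_filter.mp ha).2)) ?_ ?_ ?_ ?_ ?_
  · intro g _
    rw [Finset.mem_filter, Finset.mem_range, hlev]
    exact ⟨ZMod.val_lt _, F.val_coprime_d_mul_seven n g⟩
  · intro a _; exact Finset.mem_univ _
  · intro g _
    ext
    rw [ZMod.coe_unitOfCoprime, ZMod.natCast_zmod_val]
  · intro a ha
    rw [Finset.mem_filter, Finset.mem_range, hlev] at ha
    show ((ZMod.unitOfCoprime a _ : (ZMod (7 ^ (n + 1) * F.d))ˣ) : ZMod (7 ^ (n + 1) * F.d)).val = a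
    rw [ZMod.coe_unitOfCoprime, ZMod.val_natCast, Nat.mod_eq_of_lt ha.1]
  · intro g _; rfl

/-- **Lang's layer as a sum over `(ℤ/mₙ)ˣ`**: `stickelbergerLayer 7 |D| ψ rInv n = Σ_c C(ψ(c̄)·c̄)·(1+T)^{rInv_n(c̄)}`.
[cite: Lang1990, Ch. 10 §2 (2)–(3) (PDF p. 171)] -/
theorem stickelbergerLayer_eq_sum_units (n : ℕ) [NeZero (7 ^ (n + 1) * F.d)] :
    stickelbergerLayer 7 F.d F.oddBranchSeven F.rInv n =
      ∑ c : (ZMod (7 ^ (n + 1) * F.d))ˣ,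
        C (F.oddBranchSeven ((((c : ZMod (7 ^ (n + 1) * F.d))).val : ℕ) : ZMod (F.d * 7)) *
            ((((c : ZMod (7 ^ (n + 1) * F.d))).val : ℕ) : ℤ_[7])) *
          (1 + X) ^ F.rInv n ((c : ZMod (7 ^ (n + 1) * F.d))).val := by
  haveI : Fact (Nat.Prime 7) := ⟨Nat.prime_seven⟩
  rw [stickelbergerLayer_def,
    ← F.sum_units_eq_sum_filter_coprime n (fun a => C (F.oddBranchSeven (a : ZMod (F.d * 7)) * (a : ℤ_[7])) * (1 + X) ^ F.rInv n a)]

/-! ## §4 Cancellation of the level modulo `h_n`; the floor identity -/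

/-- `|D|` is a unit of `ℤ₇`. [cite: Lang1990, Ch. 10 §1 (PDF p. 167, «d prime to p»)] -/
theorem isUnit_natCast_d : IsUnit ((F.d : ℕ) : ℤ_[7]) := by
  haveI : Fact (Nat.Prime 7) := ⟨Nat.prime_seven⟩
  rw [PadicInt.isUnit_iff]
  have h1 : ‖((F.d : ℕ) : ℤ_[7])‖ ≤ 1 := PadicInt.norm_le_one _
  have h2 : ¬ ‖((F.d : ℕ) : ℤ_[7])‖ < 1 := by
    rw [← Int.cast_natCast, PadicInt.norm_int_lt_one_iff_dvd, Int.natCast_dvd_natCast,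
      ← Nat.Prime.coprime_iff_not_dvd Nat.prime_seven]
    exact F.d_coprime_seven.symm
  exact le_antisymm h1 (not_lt.mp h2)

/-- **Cancellation of `C(mₙ)` modulo `h_n`**: `h_n ∣ C(mₙ)·f ⇒ h_n ∣ f` (`mₙ = 7^{n+1}|D|`, `|D| ∈ ℤ₇ˣ`,
`layerModulus_dvd_of_dvd_C_pow_mul`). [cite: Lang1990, Ch. 5 §1 (PDF pp. 115–116)] -/
theorem mem_span_layerModulus_of_C_level_mul_mem (n : ℕ) {f : IwasawaAlgebra 7}
    (h : C (((7 ^ (n + 1) * F.d : ℕ) : ℤ_[7])) * f ∈ Ideal.span {layerModulus 7 n}) :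
    f ∈ Ideal.span {layerModulus 7 n} := by
  haveI : Fact (Nat.Prime 7) := ⟨Nat.prime_seven⟩
  rw [Ideal.mem_span_singleton] at h ⊢
  obtain ⟨du, hdu⟩ := F.isUnit_natCast_d
  apply layerModulus_dvd_of_dvd_C_pow_mul 7 n (n + 1)
  have hrw : C (((7 ^ (n + 1) * F.d : ℕ) : ℤ_[7])) * f =
      C (du : ℤ_[7]) * (C (((7 : ℕ) : ℤ_[7]) ^ (n + 1)) * f) := by
    rw [← mul_assoc, ← map_mul, hdu]; push_cast; ring
  rw [hrw] at h
  exact (Units.isUnit (Units.map (C : ℤ_[7] →+* IwasawaAlgebra 7).toMonoidHom du)).dvd_mul_left.mp h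

/-- **`mₙ·⌊N c̄/mₙ⌋ = N·c̄ − (Nc)‾`** in `ℤ` (`N̄` the unit of `N` in `ℤ/mₙ`). [cite: Lang1990, Ch. 1 §2 (PDF p. 15, «⟨Na/N⟩»)] -/
theorem natCast_level_mul_div (n : ℕ) [NeZero (7 ^ (n + 1) * F.d)] {N : ℕ} (hN : N.Coprime (7 ^ (n + 1) * F.d))
    (c : (ZMod (7 ^ (n + 1) * F.d))ˣ) :
    ((7 ^ (n + 1) * F.d : ℕ) : ℤ) * ((N * ((c : ZMod (7 ^ (n + 1) * F.d))).val / (7 ^ (n + 1) * F.d) : ℕ) : ℤ) =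
      (N : ℤ) * ((((c : ZMod (7 ^ (n + 1) * F.d))).val : ℕ) : ℤ) -
        ((((ZMod.unitOfCoprime N hN * c : (ZMod (7 ^ (n + 1) * F.d))ˣ) : ZMod (7 ^ (n + 1) * F.d)).val : ℕ) : ℤ) := by
  have hmod : ((ZMod.unitOfCoprime N hN * c : (ZMod (7 ^ (n + 1) * F.d))ˣ) : ZMod (7 ^ (n + 1) * F.d)).val =
      N * ((c : ZMod (7 ^ (n + 1) * F.d))).val % (7 ^ (n + 1) * F.d) := by
    rw [Units.val_mul, ZMod.coe_unitOfCoprime, ZMod.val_mul, ZMod.val_natCast, Nat.mod_mul_mod]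
  rw [hmod]
  have h := Nat.div_add_mod (N * ((c : ZMod (7 ^ (n + 1) * F.d))).val) (7 ^ (n + 1) * F.d)
  have h' := congrArg (Nat.cast : ℕ → ℤ) h
  push_cast at h' ⊢
  linear_combination h'

end GenusFrame

end Summit.BirchSwinnertonDyer.Rank1Residual.Additive.GenusSeven

end
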